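import Summits.ResolutionOfSingularities.ResolutionOfSingularities.Theorems.PurelyInseparableDim4PhiLineChartHom
import HarnessLib

/-!
# (K-Φ2) chain dictionary VII: TRANSPORT OF A LABEL DECOMPOSITION — `θ(Ψ(ℓ) + Q) = x_j^d · (Ψ(ℓ′) + x_j · Q′)`

Cell `res-dim4-pi` (D-0157 DOOR 2), Φ = β_h line of res-dim4-idea-1 (CARD I-1-8 (C2) «the arrival frame is a label»; memo §6.2 (P2): «the `U′`-free
degree-`d` part of the transform is `F(Z′)`: parent monomials with `|B| = d` and `A = 0`»). A LABEL decomposition of the residual in a linear frame is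
`G = Ψ(ℓ₁, …, ℓ_r) + Q` with `Ψ` a form of degree `d` in the `y`-letters and `Q ∈ 𝔪₀^{d+1}` (`δ > 1`, cf. (K-Φ3) IV / (K-Φ2) III
`algebraMap_mem_yIdeal_pow_sup`). Under the chart step `θ = translate b ∘ coordBlowupSubst K univ j` ((K-Φ2) I) at a point through which the
`ℓ_i` pass:

* `aeval_mul_of_isHomogeneous` — `Ψ(x_j · g) = x_j^d · Ψ(g)` for `Ψ` homogeneous of degree `d` (any index type);
* `translate_coordBlowupSubst_aeval_linearForms` — `θ(Ψ(ℓ)) = x_j^d · Ψ(ℓ′)` with `ℓ′_i = ℓ_i` minus its `j`-th coefficient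
  (`localRingHom_chart_linearForm`'s polynomial side);
* `translate_coordBlowupSubst_mem_span_X_pow` — `θ(𝔪₀^n) ⊆ (x_j^n)`;
* **`translate_coordBlowupSubst_label`** — `θ(Ψ(ℓ) + Q) = x_j^d · (Ψ(ℓ′) + x_j · Q′)` for some `Q′`; and with (K-Φ2) I
  **`chartTransform_translate_label`**: `H₀ = translate b (chartTransform d univ j G) = Ψ(ℓ′) + x_j · Q′` when `ord₀ G ≥ d` — the weak transform's
  residual agrees with the parent's `y`-form on the transported linear letters MODULO THE EXCEPTIONAL VARIABLE `x_j` (so its `u`-free tangent part in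
  the arrival frame is `Ψ`, the input (ii) of (K-Φ3) III/VI).

[OURS · counted 0 · AI work weaker than expert review.] Nothing here proves K2(p), the β_h line, or resolution of singularities in dimension ≥ 4 /
characteristic p.

Sources: V. Cossart, U. Jannsen, S. Saito, LNM **2270** (2020), Lemma 12.1/12.2 (2) («`x′` near ⇒ prelabel»), Def. 8.4 [`CossartJannsenSaito2020`];
V. Cossart, O. Piltant, J. Algebra 320 (2008) §4 pp. 11–12 [`CossartPiltant2008`].
-/

set_option linter.dupNamespace false

noncomputable section

namespace Summit.ResolutionOfSingularities.ResolutionOfSingularities.Theorems.PIDim4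

namespace PhiLine

open MvPolynomial Finset IsLocalRing
open Literature.AlgebraicGeometry.Resolution
open Literature.AlgebraicGeometry.Resolution.Hauser2010

variable {K : Type} [Field K]

/-- **`Ψ(x · g) = x^d · Ψ(g)`** for a form `Ψ` of degree `d` (any index type, any commutative `K`-algebra). [folklore] -/
theorem aeval_mul_of_isHomogeneous {ι : Type*} {A : Type*} [CommRing A] [Algebra K A] {Ψ : MvPolynomial ι K} {d : ℕ}
    (hΨ : Ψ.IsHomogeneous d) (x : A) (g : ι → A) : aeval (fun i => x * g i) Ψ = x ^ d * aeval g Ψ := by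
  classical
  conv_lhs => rw [Ψ.as_sum]
  conv_rhs => rw [Ψ.as_sum]
  rw [map_sum, map_sum, Finset.mul_sum]
  refine Finset.sum_congr rfl fun m hm => ?_
  have hdeg : m.degree = d := by
    have h := hΨ (mem_support_iff.mp hm)
    rw [Finsupp.degree_eq_weight_one]; exact h
  rw [aeval_monomial, aeval_monomial, Finsupp.prod, Finsupp.prod]
  have hprod : ∏ i ∈ m.support, (x * g i) ^ m i = x ^ d * ∏ i ∈ m.support, g i ^ m i := by
    have hdeg' : d = ∑ i ∈ m.support, m i := by rw [← hdeg]; rfl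
    rw [hdeg', ← Finset.prod_pow_eq_pow_sum, ← Finset.prod_mul_distrib]
    exact Finset.prod_congr rfl fun i _ => mul_pow x (g i) (m i)
  rw [hprod]; ring

/-- **`θ(Ψ(ℓ)) = x_j^d · Ψ(ℓ′)`**: the chart step on a form in linear letters through the new point (`ℓ_i(b + e_j) = 0`), `ℓ′_i = ℓ_i` with the
`j`-th coefficient dropped. [cite: CossartJannsenSaito2020, Lemma 12.2] -/
theorem translate_coordBlowupSubst_aeval_linearForms {ι : Type*} {j : Fin 4} {b : Fin 4 → K} (hbj : b j = 0) (ℓ : ι → Fin 4 → K)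
    (hnear : ∀ i, ∑ t, ℓ i t * Function.update b j 1 t = 0) {Ψ : MvPolynomial ι K} {d : ℕ} (hΨ : Ψ.IsHomogeneous d) :
    PointBlowup.translate b (coordBlowupSubst K (↑(Finset.univ : Finset (Fin 4))) j (aeval (fun i => ∑ t, C (ℓ i t) * X t) Ψ)) =
      X j ^ d * aeval (fun i => ∑ t, C (Function.update (ℓ i) j 0 t) * X t) Ψ := by
  have hcomp : ∀ F : MvPolynomial ι K, PointBlowup.translate b (coordBlowupSubst K (↑(Finset.univ : Finset (Fin 4))) j (aeval (fun i => ∑ t, C (ℓ i t) * X t) F)) =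
      aeval (fun i => PointBlowup.translate b (coordBlowupSubst K (↑(Finset.univ : Finset (Fin 4))) j (∑ t, C (ℓ i t) * X t))) F := by
    intro F
    exact congrArg (fun ψ : MvPolynomial ι K →ₐ[K] MvPolynomial (Fin 4) K => ψ F)
      (MvPolynomial.comp_aeval (f := fun i => (∑ t, C (ℓ i t) * X t : MvPolynomial (Fin 4) K))
        ((aeval fun i => (X i + C (b i) : MvPolynomial (Fin 4) K)).comp (coordBlowupSubst K (↑(Finset.univ : Finset (Fin 4))) j)))
  rw [hcomp]
  have hval : (fun i => PointBlowup.translate b (coordBlowupSubst K (↑(Finset.univ : Finset (Fin 4))) j (∑ t, C (ℓ i t) * X t))) =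
      fun i => X j * ∑ t, C (Function.update (ℓ i) j 0 t) * X t := by
    funext i
    rw [translate_coordBlowupSubst_linearForm hbj, hnear i, C_0, add_zero]
  rw [hval, aeval_mul_of_isHomogeneous hΨ]

/-- **`θ(𝔪₀^n) ⊆ (x_j^n)`**: every variable goes to a multiple of `x_j`. [cite: Hu2025, Prop. 5.3] -/
theorem translate_coordBlowupSubst_mem_span_X_pow {j : Fin 4} {b : Fin 4 → K} (hbj : b j = 0) {n : ℕ} {Q : MvPolynomial (Fin 4) K}
    (hQ : Q ∈ Literature.AlgebraicGeometry.Resolution.originIdeal K 4 ^ n) :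
    PointBlowup.translate b (coordBlowupSubst K (↑(Finset.univ : Finset (Fin 4))) j Q) ∈ Ideal.span {(X j : MvPolynomial (Fin 4) K) ^ n} := by
  set θ : MvPolynomial (Fin 4) K →ₐ[K] MvPolynomial (Fin 4) K :=
    (aeval fun i => (X i + C (b i) : MvPolynomial (Fin 4) K)).comp (coordBlowupSubst K (↑(Finset.univ : Finset (Fin 4))) j) with hθ
  have hθapp : ∀ F, θ F = PointBlowup.translate b (coordBlowupSubst K (↑(Finset.univ : Finset (Fin 4))) j F) := fun F => rfl
  have hmap : (Literature.AlgebraicGeometry.Resolution.originIdeal K 4).map (θ : MvPolynomial (Fin 4) K →+* MvPolynomial (Fin 4) K) ≤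
      Ideal.span {(X j : MvPolynomial (Fin 4) K)} := by
    rw [Literature.AlgebraicGeometry.Resolution.originIdeal_eq_span, Ideal.map_span, Ideal.span_le]
    rintro _ ⟨_, ⟨i, rfl⟩, rfl⟩
    rw [SetLike.mem_coe, Ideal.mem_span_singleton]
    change X j ∣ θ (X i)
    rw [hθapp]
    by_cases hij : i = j
    · subst hij; rw [translate_coordBlowupSubst_X_self hbj]
    · rw [translate_coordBlowupSubst_X_of_ne hij hbj]; exact Dvd.intro_left _ rfl
  have h := Ideal.mem_map_of_mem (θ : MvPolynomial (Fin 4) K →+* MvPolynomial (Fin 4) K) hQ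
  rw [Ideal.map_pow] at h
  have h2 := Ideal.pow_right_mono hmap n h
  rw [Ideal.span_singleton_pow] at h2
  rw [← hθapp]; exact h2

/-- **Transport of a label decomposition**: `θ(Ψ(ℓ) + Q) = x_j^d · (Ψ(ℓ′) + x_j · Q′)` for `Ψ` a form of degree `d` in linear letters through the
new point and `Q ∈ 𝔪₀^{d+1}`. [cite: CossartJannsenSaito2020, Lemma 12.2] -/
theorem translate_coordBlowupSubst_label {ι : Type*} {j : Fin 4} {b : Fin 4 → K} (hbj : b j = 0) (ℓ : ι → Fin 4 → K)
    (hnear : ∀ i, ∑ t, ℓ i t * Function.update b j 1 t = 0) {Ψ : MvPolynomial ι K} {d : ℕ} (hΨ : Ψ.IsHomogeneous d)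
    {Q : MvPolynomial (Fin 4) K} (hQ : Q ∈ Literature.AlgebraicGeometry.Resolution.originIdeal K 4 ^ (d + 1)) :
    ∃ Q' : MvPolynomial (Fin 4) K,
      PointBlowup.translate b (coordBlowupSubst K (↑(Finset.univ : Finset (Fin 4))) j (aeval (fun i => ∑ t, C (ℓ i t) * X t) Ψ + Q)) =
        X j ^ d * (aeval (fun i => ∑ t, C (Function.update (ℓ i) j 0 t) * X t) Ψ + X j * Q') := by
  obtain ⟨Q', hQ'⟩ := Ideal.mem_span_singleton'.mp (translate_coordBlowupSubst_mem_span_X_pow hbj hQ)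
  refine ⟨Q', ?_⟩
  have hadd : PointBlowup.translate b (coordBlowupSubst K (↑(Finset.univ : Finset (Fin 4))) j (aeval (fun i => ∑ t, C (ℓ i t) * X t) Ψ + Q)) =
      PointBlowup.translate b (coordBlowupSubst K (↑(Finset.univ : Finset (Fin 4))) j (aeval (fun i => ∑ t, C (ℓ i t) * X t) Ψ)) +
        PointBlowup.translate b (coordBlowupSubst K (↑(Finset.univ : Finset (Fin 4))) j Q) := by
    unfold PointBlowup.translate; rw [map_add, map_add]
  rw [hadd, translate_coordBlowupSubst_aeval_linearForms hbj ℓ hnear hΨ, ← hQ']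
  ring

/-- **The weak transform's residual modulo the exceptional variable**: if `G = Ψ(ℓ) + Q` (`Ψ` a form of degree `d` in linear letters through the new
point, `Q ∈ 𝔪₀^{d+1}`, `d ≤ ord₀ G`), then `H₀ = translate b (chartTransform d univ j G) = Ψ(ℓ′) + x_j · Q′`. [cite: CossartJannsenSaito2020, Lemma 12.2] -/
theorem chartTransform_translate_label {ι : Type*} {j : Fin 4} {b : Fin 4 → K} (hbj : b j = 0) (ℓ : ι → Fin 4 → K)
    (hnear : ∀ i, ∑ t, ℓ i t * Function.update b j 1 t = 0) {Ψ : MvPolynomial ι K} {d : ℕ} (hΨ : Ψ.IsHomogeneous d)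
    {Q G : MvPolynomial (Fin 4) K} (hQ : Q ∈ Literature.AlgebraicGeometry.Resolution.originIdeal K 4 ^ (d + 1))
    (hG : G = aeval (fun i => ∑ t, C (ℓ i t) * X t) Ψ + Q) (hd : (d : ℕ∞) ≤ ordZero G) :
    ∃ Q' : MvPolynomial (Fin 4) K,
      PointBlowup.translate b (CentreBlowup.chartTransform d Finset.univ j G) = aeval (fun i => ∑ t, C (Function.update (ℓ i) j 0 t) * X t) Ψ + X j * Q' := by
  obtain ⟨Q', hQ'⟩ := translate_coordBlowupSubst_label hbj ℓ hnear hΨ hQ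
  refine ⟨Q', ?_⟩
  have h := translate_coordBlowupSubst_eq_X_pow_mul hbj G hd
  rw [hG, hQ', ← hG] at h
  have hX : (X j : MvPolynomial (Fin 4) K) ^ d = monomial (Finsupp.single j d) 1 := by rw [X_pow_eq_monomial]
  rw [hX, monomial_one_mul_cancel_left_iff] at h
  exact h.symm

end PhiLine

end Summit.ResolutionOfSingularities.ResolutionOfSingularities.Theorems.PIDim4

end
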